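import Literature.IUT.LogThetaLattice.GlobalKummerNonInterferenceProofs3
import HarnessLib

/-!
# [IUTchIII] Proposition 3.10 (ii) at the places model — NON-VACUITY of the junctions (J1)
# (proof-only companion №4 of `GlobalKummerNonInterference.lean`; DAG node **IUTchIII:Prop3.10(ii)**)

Proof-only NON-VACUITY companion (abc-iut cell, block C / wave W6, seat abc-iut-w6-d079) of
`GlobalKummerNonInterferenceProofs3.lean` (p429902: the junctions (J1)/(J1′)/(J2) of [IUTchIII] Prop. 3.10 (ii),
second paragraph, at abc-iut-L6-t5's PLACES MODEL). S. Mochizuki, *Inter-universal Teichmüller theory III*, kurims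
manuscript (May 2020) of PRIMS **57** (2021), §3, Proposition 3.10 (ii) pp. 148–149 [claim: Mochizuki2012, status:
disputed] (D-0012 claim key). NO new definitions; no side taken on [IUTchIII] Cor. 3.12; typed ≠ proved elsewhere.

WHY THIS FILE. In (J1) (`Prop310ii_logKummer'_of_torsionTrivial_places` / `…_modTorsion_places`) the "mutual
compatibility up to identity indeterminacies" clause of the corrected typing `Prop310ii_logKummer'` is an implication
`Rel m g g' → act (m+1) g' = act m g` whose antecedent is "both Kummer images lie in every local monoid" and whose
coric action is multiplication on the `×μ`-quotient `Kˣ/(torsion)`. A vacuity audit (cell rule RQ7 / NV rows) must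
ask: (a) is `Rel` ever satisfied? (b) is the coric action non-trivial, i.e. is the identity-indeterminacy quotient a
GENUINE quotient rather than the zero action? Both answered here, classically:

* `mem_localMonoids_places_of_pow_eq_one`, `one_mem_localMonoids_places` — the CONVERSE reading of the first display:
  every root of unity (in particular `1`) lies in every local monoid `Ψ_v` (p405475 + Kronecker p404134, BY NAME); so
  `Rel` holds at `(1, 1)` and at every pair of roots of unity: `rel_modTorsion_places_of_pow_eq_one`.
* `toPermHom_modTorsion_ne_one_of_not_isOfFinOrder` — a NON-torsion unit acts NON-trivially on `Kˣ/(torsion)`;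
  `not_isOfFinOrder_mk0_two` — `2 ∈ Kˣ` is not torsion (`|φ(2)| = 2 ≠ 1`); hence
  `toPermHom_modTorsion_ne_one` — the coric action of (J1)'s explicit instance is NOT the trivial homomorphism: the
  compatibility clause of (J1) is obtained by quotienting out EXACTLY the torsion ("[harmless!] identity
  indeterminacies", Def. 1.1 (iv) p. 27), not by killing the action.

HONEST SCOPE as in p429902: one number field `K` stands for the coric `𝕄⊛_MOD(^{n,∘}𝓗𝓣^𝒟)_j`; classical number-field
bookkeeping only. [claim: Mochizuki2012, status: disputed] for every quoted phrase.
-/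

noncomputable section

namespace Literature.IUT.LogThetaLattice

open NumberField IsDedekindDomain

universe u

variable {K : Type u} [Field K] [NumberField K]

/-- Converse reading of the first display of [IUTchIII] Prop. 3.10 (ii) (p. 148) at the places model: a ROOT OF
UNITY lies in every local monoid `Ψ_v` (nonzero `v`-integers / `|φ(x)| ≤ 1`) — `(†𝕄⊛μ_MOD)_α ⊆ (†𝕄⊛_MOD)_α ∩ Π_v Ψ_v`
(p405475 `localMonoidsDetectIntegrality_places` + p404134 `integralAtAllPlaces_iff_rootOfUnity`, BY NAME). PROVED.
[claim: Mochizuki2012, status: disputed] -/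
theorem mem_localMonoids_places_of_pow_eq_one {x : K} {n : ℕ} (hn : 0 < n) (hx : x ^ n = 1)
    (v : HeightOneSpectrum (𝓞 K) ⊕ (K →+* ℂ)) :
    x ∈ Sum.elim (fun w => {x : K | x ≠ 0 ∧ w.valuation K x ≤ 1})
      (fun φ => {x : K | x ≠ 0 ∧ ‖φ x‖ ≤ 1}) v := by
  have hx0 : x ≠ 0 := by
    rintro rfl
    rw [zero_pow hn.ne'] at hx
    exact zero_ne_one hx
  exact ((localMonoidsDetectIntegrality_places K) x).mpr
    ⟨hx0, (integralAtAllPlaces_iff_rootOfUnity K hx0).mpr ⟨n, hn, hx⟩⟩ v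

/-- In particular `1` lies in every local monoid of the places model. PROVED. [claim: Mochizuki2012, status: disputed] -/
theorem one_mem_localMonoids_places (v : HeightOneSpectrum (𝓞 K) ⊕ (K →+* ℂ)) :
    (1 : K) ∈ Sum.elim (fun w => {x : K | x ≠ 0 ∧ w.valuation K x ≤ 1})
      (fun φ => {x : K | x ≠ 0 ∧ ‖φ x‖ ≤ 1}) v :=
  mem_localMonoids_places_of_pow_eq_one (n := 1) Nat.one_pos (one_pow 1) v

section RelInhabited

variable {Km : ℤ → Type u} [∀ m, Field (Km m)] {Kc : Type u} [Field Kc] [NumberField Kc]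

/-- **NON-VACUITY (a) of (J1)**: the relation of `Prop310ii_logKummer'_modTorsion_places` ("both members lie, through
their Kummer images, in every local monoid" — the domains of the log-links, Rmk. 1.1.1 (i)) is INHABITED: it holds for
any pair of roots of unity of the two Frobenius-like copies, in particular at `(1, 1)`, for every `m`. PROVED.
[claim: Mochizuki2012, status: disputed] -/
theorem rel_modTorsion_places_of_pow_eq_one (κ : ∀ m, Km m ≃+* Kc) (m : ℤ) {g : (Km m)ˣ}
    {g' : (Km (m + 1))ˣ} {n n' : ℕ} (hn : 0 < n) (hg : g ^ n = 1) (hn' : 0 < n') (hg' : g' ^ n' = 1) :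
    (∀ v : HeightOneSpectrum (𝓞 Kc) ⊕ (Kc →+* ℂ),
        (κ m (g : Km m) : Kc) ∈ Sum.elim (fun w => {x : Kc | x ≠ 0 ∧ w.valuation Kc x ≤ 1})
          (fun φ => {x : Kc | x ≠ 0 ∧ ‖φ x‖ ≤ 1}) v) ∧
      (∀ v : HeightOneSpectrum (𝓞 Kc) ⊕ (Kc →+* ℂ),
        (κ (m + 1) (g' : Km (m + 1)) : Kc) ∈ Sum.elim (fun w => {x : Kc | x ≠ 0 ∧ w.valuation Kc x ≤ 1})
          (fun φ => {x : Kc | x ≠ 0 ∧ ‖φ x‖ ≤ 1}) v) := by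
  refine ⟨mem_localMonoids_places_of_pow_eq_one hn ?_, mem_localMonoids_places_of_pow_eq_one hn' ?_⟩
  · rw [← map_pow, ← Units.val_pow_eq_pow_val, hg, Units.val_one, map_one]
  · rw [← map_pow, ← Units.val_pow_eq_pow_val, hg', Units.val_one, map_one]

/-- The relation of (J1) holds at `(1, 1)` for every `m`. PROVED. [claim: Mochizuki2012, status: disputed] -/
theorem rel_modTorsion_places_one_one (κ : ∀ m, Km m ≃+* Kc) (m : ℤ) :
    (∀ v : HeightOneSpectrum (𝓞 Kc) ⊕ (Kc →+* ℂ),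
        (κ m ((1 : (Km m)ˣ) : Km m) : Kc) ∈ Sum.elim (fun w => {x : Kc | x ≠ 0 ∧ w.valuation Kc x ≤ 1})
          (fun φ => {x : Kc | x ≠ 0 ∧ ‖φ x‖ ≤ 1}) v) ∧
      (∀ v : HeightOneSpectrum (𝓞 Kc) ⊕ (Kc →+* ℂ),
        (κ (m + 1) ((1 : (Km (m + 1))ˣ) : Km (m + 1)) : Kc) ∈
          Sum.elim (fun w => {x : Kc | x ≠ 0 ∧ w.valuation Kc x ≤ 1})
            (fun φ => {x : Kc | x ≠ 0 ∧ ‖φ x‖ ≤ 1}) v) :=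
  rel_modTorsion_places_of_pow_eq_one κ m (n := 1) (n' := 1) Nat.one_pos (one_pow 1) Nat.one_pos (one_pow 1)

end RelInhabited

/-- **NON-VACUITY (b) of (J1)**, first step: a unit that is NOT torsion acts NON-trivially on the `×μ`-quotient
`Kˣ/(torsion)` (it moves the class of `1`). So the coric action of `Prop310ii_logKummer'_modTorsion_places` kills
EXACTLY the torsion — the "[harmless!] identity indeterminacies" of Def. 1.1 (iv), p. 27 — and nothing more. PROVED.
[claim: Mochizuki2012, status: disputed] -/
theorem toPermHom_modTorsion_ne_one_of_not_isOfFinOrder {L : Type u} [Field L] (u : Lˣ)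
    (hu : ¬ IsOfFinOrder u) : MulAction.toPermHom Lˣ (Lˣ ⧸ CommGroup.torsion Lˣ) u ≠ 1 := by
  intro h
  have h1 : (u • ((1 : Lˣ) : Lˣ ⧸ CommGroup.torsion Lˣ)) = ((1 : Lˣ) : Lˣ ⧸ CommGroup.torsion Lˣ) := by
    have := congrArg (fun f : Equiv.Perm (Lˣ ⧸ CommGroup.torsion Lˣ) => f ((1 : Lˣ) : Lˣ ⧸ CommGroup.torsion Lˣ)) h
    simpa using this
  rw [MulAction.Quotient.smul_coe, smul_eq_mul, mul_one, QuotientGroup.eq, mul_one] at h1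
  exact hu ((CommGroup.mem_torsion _).mp h1).of_inv

/-- `2 ∈ Kˣ` is NOT a torsion unit of a number field (`|φ(2)| = 2 ≠ 1` under any complex embedding, whereas roots of
unity have absolute value `1`: `norm_embedding_eq_one_of_mem_localMonoids_places` route, here done directly). PROVED.
[claim: Mochizuki2012, status: disputed] -/
theorem not_isOfFinOrder_mk0_two :
    ¬ IsOfFinOrder (Units.mk0 (2 : K) two_ne_zero) := by
  intro h
  obtain ⟨n, hn, hpow⟩ := isOfFinOrder_iff_pow_eq_one.mp h
  have h2 : (2 : K) ^ n = 1 := by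
    have := congrArg (fun u : Kˣ => (u : K)) hpow
    simpa [Units.val_pow_eq_pow_val] using this
  have hne : Nonempty (K →+* ℂ) := by
    rw [← Fintype.card_pos_iff, NumberField.Embeddings.card]
    exact Module.finrank_pos
  obtain ⟨φ⟩ := hne
  have h3 : ‖φ (2 : K)‖ ^ n = 1 := by rw [← norm_pow, ← map_pow, h2, map_one, norm_one]
  have h4 : ‖φ (2 : K)‖ = 2 := by rw [map_ofNat, Complex.norm_ofNat]
  rw [h4] at h3
  have : (2 : ℝ) ^ n ≥ 2 ^ 1 := pow_le_pow_right₀ one_le_two hn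
  linarith

/-- **NON-VACUITY (b) of (J1)**: the coric action of the explicit instance `Prop310ii_logKummer'_modTorsion_places`
— multiplication of `Kˣ` on `Kˣ/(torsion)` — is NOT the trivial homomorphism for any number field `K`. Together with
`rel_modTorsion_places_one_one`: neither side of the compatibility implication of (J1) is degenerate. PROVED.
[claim: Mochizuki2012, status: disputed] -/
theorem toPermHom_modTorsion_ne_one :
    MulAction.toPermHom Kˣ (Kˣ ⧸ CommGroup.torsion Kˣ) ≠ 1 := by
  intro h
  exact toPermHom_modTorsion_ne_one_of_not_isOfFinOrder _ (not_isOfFinOrder_mk0_two (K := K))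
    (by rw [h, MonoidHom.one_apply])

end Literature.IUT.LogThetaLattice

end
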